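import Literature.AlgebraicGeometry.Motives.AbelianVarietyPicZeroOfAmple
import Literature.AlgebraicGeometry.Motives.AbelianVarietyPhiThetaFibres
import Literature.AlgebraicGeometry.AbelianSchemes.AbelianSchemeDualPairSlice
import Literature.Geometry.Kaehler.ComplexTorusKHStructure
import Literature.GroupTheory.FiniteAbelian.PiZModSquareChainUnique
import HarnessLib

/-!
# The type of a polarisation is the analytic type of its first Chern class on the period lattice
# ([Lange 2023] §3.2.1 «`K(H) ≃ K(D)`», §1.5.1; [MFK94] App. 7A «`ker(λ) ≅ ∏ ℤ/δᵢ × ∏ μ_{δᵢ}`»)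

Layer `Literature/AlgebraicGeometry/Motives`, namespace `Literature.AlgebraicGeometry.Motives.AbelianVariety` (+ two
wrappers in `Literature.AlgebraicGeometry.AbelianSchemes.AbelianSchemeOver.Polarization`).  PROOF FILE: theorems only;
no definition, no named fact, no instance, no `sorry`.  Cell `hodgecm-mathlib` (D-0151), U-DAG brick B4, the TYPE-MATCH
seam named by B-p03 (g11) for the unconditional head `exists_isAdmissibleAt` (router B-plan1 (g10) R64 (1)): the
algebraic type `δ` of a polarisation (★ D2 `AbelianSchemeOver.Polarization.HasType δ`: at every geometric point the
kernel of `λ̄` on points is the image of an injective homomorphism from `(Πᵢ ℤ/δᵢ)²`) EQUALS the analytic (Frobenius /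
elementary-divisor) type of the first Chern class `E = c₁(𝒪(Θ)^an)` of any divisor `Θ` with `λ̄ = Λ(𝒪(Θ))` on the period
lattice of a uniformising torus (★ `ComplexTorus.IsPolarizationType Φ E d`).  HC_CM is proved only modulo the 7 printed
citations until rung 0 closes; this file discharges none of them (books 0).

For a complex abelian variety `A` uniformised by `φ : X = V/Φ(ℤ^ι) → A(ℂ)` compatible with the group laws (the J′
variable block of ★ `AbelianVarietyWeilPairingAnalytic` / `AbelianVarietyPicZeroOfAmple`), a Cartier divisor `Θ` and an
Appell–Humbert datum `p` with `⟦a_p⟧ = [𝒪(Θ)^an]` (`E := p.form = Im H`, integer Gram matrix `G = intGram Φ E`):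

* §1 THE KERNEL BRIDGE `K(Θ)(ℂ) = K(H)`: `phiL_picClass_eq_one_iff_mem_KTheta` (`φ_{[𝒪(Θ)^an]}(t̄) = 1 ↔ φ t̄ ∈ K(Θ)`;
  (⇒) is ★ `phiL_eq_one_imp_mem_KTheta` = GAGA injectivity on `Pic`, cell row B1; (⇐) is ★
  `picClass_cartierDivisorLineBundle_weilDiv` + `…_eq_of_linEquiv`), `mem_kerPhiH_iff_mem_KTheta`
  (`t̄ ∈ Ker φ_H ↔ φ t̄ ∈ K(Θ)`, Lange Lemma 1.4.5 `φ_L = dualToPic ∘ φ_H` + injectivity of `X̂ → Pic(X)`), and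
  `nonempty_kerPhiH_addEquiv_KTheta` (`K(H) ≃+ K(Θ)` along `φ`) — Mumford's `K(L)` (§6/§8/§23) IS Lange's
  `K(H) = Λ(H)/Λ` ((1.14)) under the uniformisation;
* §2 THE TYPE MATCH: `eq_of_isPolarizationType_of_range_eq_KTheta` — if `(Πᵢ ℤ/δᵢ)²` injects onto `K(Θ)(ℂ)` with
  `δ₁ ∣ ⋯ ∣ δ_g` positive (the `HasType δ` clause at the point) and `E` is non-degenerate of analytic type `d` (a symplectic
  basis of the lattice with `E = (0 D; −D 0)`), then `d = δ`: `(Π ℤ/δ)² ≃ K(Θ) ≃ K(H) ≃ K(D) = (Π ℤ/d)²` (★ Lange §3.2.1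
  `kerPhiHEquivLevelGroup`) and the uniqueness of invariant factors in squared shape (★
  `GroupTheory.FiniteAbelian.pi_zmod_sq_chain_unique`, [Hungerford1974] II Thm. 2.6 (ii)); versions `…_of_isAmple`
  (non-degeneracy from ★ `det_intGram_ne_zero_of_isAmple`) and `isPolarizationType_of_range_eq_KTheta` (for a RIEMANN
  form `E`: `E` HAS analytic type `δ`, i.e. the period lattice has a symplectic basis of type `δ` for `E` — the input of the
  Siegel normal form);
* §3 THE SCHEME-SIDE WRAPPERS for a polarisation `pol` of an abelian scheme `A/S` with dual pair `D` ([MFK94] Def. 6.2–6.3,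
  ★ D2): `Polarization.mem_kerPointsAt_iff_mem_KTheta` (at a field-valued point `s` with `λ̄ = Λ(𝒪(Θ))` there — ★
  `IsLambdaOfAt` — the kernel set `K(λ̄) = kerPointsAt s` IS `K(Θ)` of the fibre: ★ `𝒫`-slice dictionary
  `valueAt_eq_iff_nonempty_iso_of_isLambdaOfAt` + ★ `nonempty_translateTensorDual_iso_iff_inv_mul_mem_KTheta`),
  `Polarization.HasType.exists_mulHom_range_eq_KTheta`, and the headlines
  `Polarization.HasType.eq_of_isPolarizationType` / `Polarization.HasType.complexTorus_isPolarizationType` — **for `pol.HasType δ`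
  and a `ℂ`-point `s`, the analytic type of `c₁(𝒪(Θ)^an)` on the period lattice of any uniformisation of the fibre `A_s`
  is `δ`.**

## References
* [Lange2023AbelianVarietiesComplex] H. Lange, *Abelian Varieties over the Complex Numbers* (2023), §1.4.2 (1.14) and
  Lemma 1.4.5 (p. 45), §1.5.1 (the type, p. 51), §3.2.1 («`K(H) ≃ K(D)`», p. 165).
* [MumfordAV1970] D. Mumford, *Abelian Varieties* (1970), §6 (the group `K(L)`, p. 60), §8 Theorem 1 (p. 77), §23
  (Riemann form and type).
* [MumfordFogartyKirwan1994] D. Mumford, J. Fogarty, F. Kirwan, *Geometric Invariant Theory*, 3rd ed. (1994), Ch. 6 §2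
  Def. 6.2–6.3 (p. 120), App. 7A (pp. 234–235: «`ker(λ) ≅ ∏ ℤ/δᵢℤ × ∏ μ_{δᵢ}`»).
* [Hungerford1974] T. W. Hungerford, *Algebra*, GTM 73 (1974), Ch. II Thm. 2.6 (ii).
-/

set_option autoImplicit false

noncomputable section

open Set Function CategoryTheory AlgebraicGeometry
open scoped Manifold ContDiff Topology
open Literature.AlgebraicGeometry.Motives Literature.Geometry.Kaehler Literature.Geometry.Kaehler.ComplexTorus
open Literature.NumberTheory.Transcendental Literature.AlgebraicGeometry.HodgeTheory

namespace Literature.AlgebraicGeometry.Motives.AbelianVariety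

section Uniformised

variable (A : AbelianVariety ℂ) {ι : Type} [Fintype ι] [DecidableEq ι] {Φ : (ι → ℝ) ≃L[ℝ] (Fin A.dim → ℂ)}
  {φ : ComplexTorus Φ → ComplexPoints A.X} (hφ : IsAnalytification (Fin A.dim → ℂ) A.X A.dim φ)
  (hadd : ∀ x y, φ (x + y) = φ x * φ y)

include hadd

omit [Fintype ι] [DecidableEq ι] in
/-- A group-law compatible uniformisation sends `0` to `1`. [cite: Lange2023AbelianVarietiesComplex, §1.1.1 (p. 16)] -/
theorem uniformisation_zero : φ 0 = 1 := by
  have h := hadd 0 0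
  rw [add_zero] at h
  exact mul_eq_left.mp h.symm

/-! ### §1 The kernel bridge `K(Θ)(ℂ) = K(H) = Ker φ_H` -/

include hφ

omit [DecidableEq ι] in
/-- **`φ_{[𝒪(Θ)^an]}(t̄) = 1` in `Pic(X)` iff `φ t̄ ∈ K(Θ) = {x | t_x^*Θ ∼ Θ}`** — the algebraic `K(Θ)` of
[MumfordAV1970, §6] is the kernel of Lange's analytic `φ_L`, `L = 𝒪(Θ)^an` (§1.4.2): (⇒) GAGA injectivity on `Pic`
(★ `phiL_eq_one_imp_mem_KTheta`); (⇐) `[𝒪(t_x^*Θ − Θ)^an] = φ_L(t̄)` (★ `picClass_cartierDivisorLineBundle_weilDiv`) and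
linearly equivalent divisors have equal analytified classes. [cite: MumfordAV1970, §6 Definition of K(L) (p. 60) and §8]
[cite: Lange2023AbelianVarietiesComplex, §1.4.2 (1.14) and Lemma 1.4.5 (p. 45)] -/
theorem phiL_picClass_eq_one_iff_mem_KTheta (Θ : CartierDivisor A.X.left) (t : ComplexTorus Φ) :
    Pic.phiL (picClass (cartierDivisorLineBundle hφ Θ)) t = 1 ↔ φ t ∈ A.KTheta Θ := by
  refine ⟨A.phiL_eq_one_imp_mem_KTheta hφ hadd Θ, fun ht ↦ ?_⟩
  rw [← picClass_cartierDivisorLineBundle_weilDiv A hφ hadd Θ t,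
    picClass_cartierDivisorLineBundle_eq_of_linEquiv hφ ((A.mem_KTheta_iff Θ (φ t)).1 ht),
    picClass_cartierDivisorLineBundle_zero hφ]

/-- **`t̄ ∈ K(H) = Ker φ_H ↔ φ t̄ ∈ K(Θ)`** for the first Chern class `E = p.form` of `[𝒪(Θ)^an]` (`p` an Appell–Humbert
datum with `⟦a_p⟧ = [𝒪(Θ)^an]`, `φ_H = phiH Φ (intGram Φ p.form)`): Lemma 1.4.5 `φ_L = dualToPic ∘ φ_H` (★
`AHData.phiL_toPic_eq_dualToPic_phiH`) and the injectivity of `X̂ → Pic(X)` (★ `dualToPic_injective`).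
[cite: Lange2023AbelianVarietiesComplex, §1.4.2 (1.14) and Lemma 1.4.5 (p. 45)] [cite: MumfordAV1970, §6 Definition of K(L) (p. 60)] -/
theorem mem_kerPhiH_iff_mem_KTheta (Θ : CartierDivisor A.X.left) (p : AHData Φ)
    (hp : AHData.toPic p = picClass (cartierDivisorLineBundle hφ Θ)) (t : ComplexTorus Φ) :
    t ∈ kerPhiH Φ (intGram Φ p.form) ↔ φ t ∈ A.KTheta Θ := by
  have hGmap : (intGram Φ p.form).map (Int.cast : ℤ → ℝ) = latticeGram Φ p.form := map_intGram Φ p.isNSForm_form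
  rw [mem_kerPhiH_iff, ← A.phiL_picClass_eq_one_iff_mem_KTheta hφ hadd Θ t, ← hp,
    AHData.phiL_toPic_eq_dualToPic_phiH p hGmap t]
  constructor
  · intro h
    rw [h, dualToPic_zero]
  · intro h
    exact dualToPic_injective Φ (h.trans (dualToPic_zero Φ).symm)

/-- **`K(H) ≃ K(Θ)(ℂ)` along the uniformisation**: `φ` restricts to an isomorphism of the finite groups `Ker φ_H ⊂ X`
(written additively) and `K(Θ) ⊂ A(ℂ)` (written multiplicatively) — Mumford's `K(L)` IS Lange's `K(H) = Λ(H)/Λ`.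
[cite: Lange2023AbelianVarietiesComplex, §1.4.2 (1.14) (p. 45)] [cite: MumfordAV1970, §6 Definition of K(L) (p. 60) and §23] -/
theorem nonempty_kerPhiH_addEquiv_KTheta (Θ : CartierDivisor A.X.left) (p : AHData Φ)
    (hp : AHData.toPic p = picClass (cartierDivisorLineBundle hφ Θ)) :
    Nonempty (kerPhiH Φ (intGram Φ p.form) ≃+ Additive (A.KTheta Θ)) := by
  have hmem := A.mem_kerPhiH_iff_mem_KTheta hφ hadd Θ p hp
  have h0 : φ 0 = 1 := A.uniformisation_zero hadd
  let f : kerPhiH Φ (intGram Φ p.form) →+ Additive (A.KTheta Θ) :=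
    { toFun := fun x ↦ Additive.ofMul ⟨φ x, (hmem x).1 x.2⟩
      map_zero' := by
        apply Additive.toMul.injective
        apply Subtype.ext
        simp only [AddSubgroup.coe_zero, toMul_ofMul]
        exact h0
      map_add' := fun x y ↦ by
        apply Additive.toMul.injective
        apply Subtype.ext
        simp only [AddSubgroup.coe_add, toMul_ofMul, toMul_add, Subgroup.coe_mul]
        exact hadd x y }
  refine ⟨AddEquiv.ofBijective f ⟨fun x y hxy ↦ ?_, fun y ↦ ?_⟩⟩
  · have h : φ x = φ y := by
      have := congrArg (fun z : Additive (A.KTheta Θ) ↦ ((Additive.toMul z : A.KTheta Θ) : A.Points ℂ)) hxy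
      simpa [f] using this
    exact Subtype.ext (hφ.isHomeomorph.injective h)
  · obtain ⟨t, ht⟩ := hφ.isHomeomorph.surjective ((Additive.toMul y : A.KTheta Θ) : A.Points ℂ)
    have htK : t ∈ kerPhiH Φ (intGram Φ p.form) := (hmem t).2 (ht ▸ (Additive.toMul y).2)
    refine ⟨⟨t, htK⟩, ?_⟩
    apply Additive.toMul.injective
    apply Subtype.ext
    simpa [f] using ht

/-! ### §2 The type match -/

/-- **THE TYPE MATCH.**  If `(Πᵢ ℤ/δᵢ)²` (`δ₁ ∣ ⋯ ∣ δ_g`, all positive — ★ `ModuliOfAbelianVarieties.IsPolarizationType δ`)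
injects into `A(ℂ)` with image `K(Θ)` (the clause of ★ D2 `Polarization.HasType δ` at the point), and the first Chern class
`E = p.form` of `[𝒪(Θ)^an]` is non-degenerate on the period lattice (`det G ≠ 0`) and of analytic type `d` (★
`ComplexTorus.IsPolarizationType`: a symplectic basis with `E = (0 D; −D 0)`), then `d = δ`:
`(Π ℤ/δ)² ≃ K(Θ) ≃ K(H) ≃ K(D) = (Π ℤ/d)²` (§1 and Lange §3.2.1 ★ `kerPhiHEquivLevelGroup`) and invariant factors in squared
shape are unique (★ `pi_zmod_sq_chain_unique`). [cite: Lange2023AbelianVarietiesComplex, §3.2.1 (p. 165) and §1.5.1 (p. 51)]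
[cite: MumfordFogartyKirwan1994, App. 7A (pp. 234–235)] [cite: Hungerford1974, Ch. II Thm. 2.6 (ii)] -/
theorem eq_of_isPolarizationType_of_range_eq_KTheta (Θ : CartierDivisor A.X.left) (p : AHData Φ)
    (hp : AHData.toPic p = picClass (cartierDivisorLineBundle hφ Θ)) (hdet : (intGram Φ p.form).det ≠ 0)
    {g : ℕ} {δ d : Fin g → ℕ} (hδ : ModuliOfAbelianVarieties.IsPolarizationType δ)
    {ψ : Multiplicative (LevelGroup δ) →* A.Points ℂ} (hψ : Injective ψ) (hrange : Set.range ψ = A.KTheta Θ)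
    (hd : ComplexTorus.IsPolarizationType Φ p.form d) : d = δ := by
  classical
  set G := intGram Φ p.form with hGdef
  have hG : G.map (Int.cast : ℤ → ℝ) = latticeGram Φ p.form := map_intGram Φ p.isNSForm_form
  -- positivity of the analytic type from non-degeneracy: `det G = (∏ dᵢ)²`
  have hdpos : ∀ i, 0 < d i := by
    have hprod : (∏ i, (d i : ℝ)) ^ 2 ≠ 0 := by
      rw [← hd.det_latticeGram, ← hG, ← Int.cast_det]
      exact_mod_cast hdet
    intro i
    have hi : (d i : ℝ) ≠ 0 := fun hz ↦
      hprod (by rw [Finset.prod_eq_zero (Finset.mem_univ i) hz, zero_pow two_ne_zero])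
    exact Nat.pos_of_ne_zero (by exact_mod_cast hi)
  have hchain : ∀ i j, i ≤ j → d i ∣ d j := fun i j hij ↦ hd.dvd hij
  -- `K(H) ≃ K(D) = (Π ℤ/d)²` from the symplectic basis (Lange §3.2.1)
  obtain ⟨-, b₀, huu, hvv, huv⟩ := hd
  let e : Fin g ⊕ Fin g ≃ ι := b₀.indexEquiv (Pi.basisFun ℤ ι)
  let b : Module.Basis ι ℤ (ι → ℤ) := b₀.reindex e
  have hb : ∀ s, b (e s) = b₀ s := fun s ↦ by simp [b]
  have huu' : ∀ i j, p.form ![Φ (intVec (b (e (Sum.inl i)))), Φ (intVec (b (e (Sum.inl j))))] = 0 :=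
    fun i j ↦ by rw [hb, hb]; exact huu i j
  have hvv' : ∀ i j, p.form ![Φ (intVec (b (e (Sum.inr i)))), Φ (intVec (b (e (Sum.inr j))))] = 0 :=
    fun i j ↦ by rw [hb, hb]; exact hvv i j
  have huv' : ∀ i j, p.form ![Φ (intVec (b (e (Sum.inl i)))), Φ (intVec (b (e (Sum.inr j))))] =
      if i = j then (d i : ℝ) else 0 := fun i j ↦ by rw [hb, hb]; exact huv i j
  have hdetT : G.transpose.det ≠ 0 := by rwa [Matrix.det_transpose]
  have eD : kerPhiH Φ G ≃+ LevelGroup d := kerPhiHEquivLevelGroup huu' hvv' huv' hG hdetT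
  -- `K(H) ≃ K(Θ)` along `φ` (§1) and `(Π ℤ/δ)² ≃ K(Θ)` from `ψ`
  obtain ⟨eK⟩ := A.nonempty_kerPhiH_addEquiv_KTheta hφ hadd Θ p hp
  have hr : ψ.range = A.KTheta Θ := SetLike.coe_injective ((MonoidHom.coe_range ψ).trans hrange)
  have eψ : Multiplicative (LevelGroup δ) ≃* A.KTheta Θ := (MonoidHom.ofInjective hψ).trans (MulEquiv.subgroupCongr hr)
  have eδd : LevelGroup δ ≃+ LevelGroup d := (MulEquiv.toAdditiveRight eψ).trans (eK.symm.trans eD)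
  exact (Literature.GroupTheory.FiniteAbelian.pi_zmod_sq_chain_unique hδ.1 hdpos hδ.2 hchain eδd).symm

/-- The type match for an AMPLE `Θ` (non-degeneracy of `c₁(𝒪(Θ)^an)` is ★ `det_intGram_ne_zero_of_isAmple`):
`HasType δ` at the point and analytic type `d` give `d = δ`. [cite: Lange2023AbelianVarietiesComplex, §3.2.1 (p. 165)]
[cite: MumfordFogartyKirwan1994, App. 7A (pp. 234–235)] -/
theorem eq_of_isPolarizationType_of_range_eq_KTheta_of_isAmple {Θ : CartierDivisor A.X.left} (hΘ : Θ.IsAmple)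
    (p : AHData Φ) (hp : AHData.toPic p = picClass (cartierDivisorLineBundle hφ Θ))
    {g : ℕ} {δ d : Fin g → ℕ} (hδ : ModuliOfAbelianVarieties.IsPolarizationType δ)
    {ψ : Multiplicative (LevelGroup δ) →* A.Points ℂ} (hψ : Injective ψ) (hrange : Set.range ψ = A.KTheta Θ)
    (hd : ComplexTorus.IsPolarizationType Φ p.form d) : d = δ :=
  A.eq_of_isPolarizationType_of_range_eq_KTheta hφ hadd Θ p hp (A.det_intGram_ne_zero_of_isAmple hφ hadd hΘ p hp)
    hδ hψ hrange hd

/-- **The first Chern class of `𝒪(Θ)^an` HAS analytic type `δ`** when it is a Riemann form: the period lattice admits a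
symplectic basis of type `δ` for `E = c₁(𝒪(Θ)^an)` (the input of the Siegel normal form at type `δ`), as soon as
`(Πᵢ ℤ/δᵢ)²` injects onto `K(Θ)(ℂ)` with `δ` a polarisation type of length `g = dim A`.  (Elementary divisors exist —
★ `IsRiemannForm.exists_isPolarizationType` — and are `δ` by the type match.)
[cite: Lange2023AbelianVarietiesComplex, §1.5.1 (p. 51) and §3.2.1 (p. 165)] [cite: MumfordFogartyKirwan1994, App. 7A (pp. 234–235)] -/
theorem isPolarizationType_of_range_eq_KTheta (Θ : CartierDivisor A.X.left) (p : AHData Φ)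
    (hp : AHData.toPic p = picClass (cartierDivisorLineBundle hφ Θ)) (hR : IsRiemannForm Φ p.form)
    {g : ℕ} (hg : A.dim = g) {δ : Fin g → ℕ} (hδ : ModuliOfAbelianVarieties.IsPolarizationType δ)
    {ψ : Multiplicative (LevelGroup δ) →* A.Points ℂ} (hψ : Injective ψ) (hrange : Set.range ψ = A.KTheta Θ) :
    ComplexTorus.IsPolarizationType Φ p.form δ := by
  obtain ⟨g', d', hd', -⟩ := hR.exists_isPolarizationType
  have hgg : g = g' := by
    have h1 := hd'.card_eq
    rw [card_eq_two_mul_finrank_of_periodIso Φ, Module.finrank_fin_fun, hg] at h1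
    omega
  subst hgg
  have hG : (intGram Φ p.form).map (Int.cast : ℤ → ℝ) = latticeGram Φ p.form := map_intGram Φ p.isNSForm_form
  have h := A.eq_of_isPolarizationType_of_range_eq_KTheta hφ hadd Θ p hp (hR.det_intGram_ne_zero hG) hδ hψ hrange hd'
  subst h
  exact hd'

end Uniformised

end Literature.AlgebraicGeometry.Motives.AbelianVariety

/-! ### §3 Scheme side: the kernel of `λ̄` on points is `K(Θ)`; the type of `pol` is the analytic type -/

namespace Literature.AlgebraicGeometry.AbelianSchemes.AbelianSchemeOver.Polarization

open Literature.AlgebraicGeometry.Modules Literature.AlgebraicGeometry.AbelianVarieties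


universe u

variable {S : Scheme.{u}} {A : AbelianSchemeOver S} {D : A.DualPair} (pol : A.Polarization D)

/-- **`K(λ̄) = K(Θ)` on points**: at a field-valued point `s` where `λ̄ = Λ(𝒪(Θ))` (★ `IsLambdaOfAt`, [MFK94] Def. 6.2),
an `Ω`-point `P` of the fibre `A_s` lies in the kernel set of `λ̄` (★ `kerPointsAt`: `λ̄(P) = λ̄(1)`) iff `t_P^*Θ ∼ Θ`
(★ `AbelianVariety.KTheta`, [MumfordAV1970] §6): `λ̄(P) = λ̄(1)` iff the `𝒫`-slices agree iff
`t_P^*𝒪(Θ) ⊗ 𝒪(Θ)⁻¹ ≅ t_1^*𝒪(Θ) ⊗ 𝒪(Θ)⁻¹` (★ `valueAt_eq_iff_nonempty_iso_of_isLambdaOfAt`) iff `P⁻¹ ∈ K(Θ)`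
(★ `nonempty_translateTensorDual_iso_iff_inv_mul_mem_KTheta`). [cite: MumfordFogartyKirwan1994, Ch. 6 §2 Definition 6.2–6.3 (p. 120)]
[cite: MumfordAV1970, §6 Definition of K(L) (p. 60) and §13] -/
theorem mem_kerPointsAt_iff_mem_KTheta {Ω : Type u} [Field Ω] (s : Spec (.of Ω) ⟶ S)
    {Θ : CartierDivisor (A.fibre s).toAbelianVariety.X.left} (hlam : A.IsLambdaOfAt s D pol.lam Θ)
    (P : (A.fibre s).toAbelianVariety.Points Ω) :
    P ∈ pol.kerPointsAt s ↔ P ∈ (A.fibre s).toAbelianVariety.KTheta Θ := by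
  rw [pol.mem_kerPointsAt_iff s P]
  refine (D.valueAt_eq_iff_nonempty_iso_of_isLambdaOfAt s hlam hlam 1 P).trans ?_
  refine ((A.fibre s).toAbelianVariety.nonempty_translateTensorDual_iso_iff_inv_mul_mem_KTheta Θ P 1).trans ?_
  rw [mul_one, inv_mem_iff]

/-- **`HasType δ` read on `K(Θ)`**: at a geometric point `s` with `λ̄ = Λ(𝒪(Θ))` there, a polarisation of type `δ` has
`K(Θ)(Ω) = ` the image of an injective homomorphism from `(Πᵢ ℤ/δᵢ)²`. [cite: MumfordFogartyKirwan1994, App. 7A (pp. 234–235)]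
[cite: MumfordAV1970, §23 (type of a polarisation)] -/
theorem HasType.exists_mulHom_range_eq_KTheta {g : ℕ} {δ : Fin g → ℕ} (hT : pol.HasType δ) {Ω : Type u} [Field Ω]
    [IsAlgClosed Ω] (s : Spec (.of Ω) ⟶ S) {Θ : CartierDivisor (A.fibre s).toAbelianVariety.X.left}
    (hlam : A.IsLambdaOfAt s D pol.lam Θ) :
    ∃ ψ : Multiplicative (((i : Fin g) → ZMod (δ i)) × ((i : Fin g) → ZMod (δ i))) →*
        (A.fibre s).toAbelianVariety.Points Ω,
      Function.Injective ψ ∧ Set.range ψ = (A.fibre s).toAbelianVariety.KTheta Θ := by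
  obtain ⟨ψ, hψ, hr⟩ := HasType.exists_mulHom pol hT Ω s
  refine ⟨ψ, hψ, ?_⟩
  rw [hr]
  ext P
  exact pol.mem_kerPointsAt_iff_mem_KTheta s hlam P

open Literature.Geometry.Kaehler Literature.Geometry.Kaehler.ComplexTorus Literature.NumberTheory.Transcendental
  Literature.AlgebraicGeometry.HodgeTheory in
/-- **THE TYPE OF A POLARISATION IS THE ANALYTIC TYPE OF `c₁(𝒪(Θ)^an)`** — equality form.  For `pol.HasType δ`, a
`ℂ`-point `s` of the base with `λ̄ = Λ(𝒪(Θ))` at `s`, a uniformisation `φ : V/Φ(ℤ^ι) → A_s(ℂ)` of the fibre compatible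
with the group laws, and an Appell–Humbert datum `p` with `⟦a_p⟧ = [𝒪(Θ)^an]` whose form is non-degenerate on the lattice:
every analytic type `d` of `E = p.form` equals `δ`. [cite: Lange2023AbelianVarietiesComplex, §3.2.1 (p. 165)]
[cite: MumfordFogartyKirwan1994, App. 7A (pp. 234–235)] [cite: Hungerford1974, Ch. II Thm. 2.6 (ii)] -/
theorem HasType.eq_of_isPolarizationType {S : Scheme.{0}} {A : AbelianSchemeOver S} {D : A.DualPair}
    (pol : A.Polarization D) {g : ℕ} {δ : Fin g → ℕ} (hT : pol.HasType δ) (s : Spec (.of ℂ) ⟶ S)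
    {Θ : CartierDivisor (A.fibre s).toAbelianVariety.X.left} (hlam : A.IsLambdaOfAt s D pol.lam Θ)
    {ι : Type} [Fintype ι] [DecidableEq ι] {Φ : (ι → ℝ) ≃L[ℝ] (Fin (A.fibre s).toAbelianVariety.dim → ℂ)}
    {φ : ComplexTorus Φ → ComplexPoints (A.fibre s).toAbelianVariety.X}
    (hφ : IsAnalytification (Fin (A.fibre s).toAbelianVariety.dim → ℂ) (A.fibre s).toAbelianVariety.X
      (A.fibre s).toAbelianVariety.dim φ)
    (hadd : ∀ x y, φ (x + y) = φ x * φ y) (p : AHData Φ)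
    (hp : AHData.toPic p = picClass (cartierDivisorLineBundle hφ Θ)) (hdet : (intGram Φ p.form).det ≠ 0)
    {d : Fin g → ℕ} (hd : ComplexTorus.IsPolarizationType Φ p.form d) : d = δ := by
  obtain ⟨ψ, hψ, hrange⟩ := HasType.exists_mulHom_range_eq_KTheta pol hT s hlam
  exact (A.fibre s).toAbelianVariety.eq_of_isPolarizationType_of_range_eq_KTheta hφ hadd Θ p hp hdet hT.1 hψ hrange hd

open Literature.Geometry.Kaehler Literature.Geometry.Kaehler.ComplexTorus Literature.NumberTheory.Transcendental
  Literature.AlgebraicGeometry.HodgeTheory in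
/-- **THE TYPE OF A POLARISATION IS THE ANALYTIC TYPE OF `c₁(𝒪(Θ)^an)`** — existence form (the Siegel-normal-form
input).  For `pol.HasType δ`, a `ℂ`-point `s` with `λ̄ = Λ(𝒪(Θ))` at `s`, a uniformisation of the fibre `A_s` of
dimension `g`, and an Appell–Humbert datum `p` of `[𝒪(Θ)^an]` whose form is a Riemann form: the period lattice has a
symplectic basis of type `δ` for `E = c₁(𝒪(Θ)^an)` (`ComplexTorus.IsPolarizationType Φ p.form δ`).
[cite: Lange2023AbelianVarietiesComplex, §1.5.1 (p. 51) and §3.2.1 (p. 165)] [cite: MumfordFogartyKirwan1994, App. 7A (pp. 234–235)] -/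
theorem HasType.complexTorus_isPolarizationType {S : Scheme.{0}} {A : AbelianSchemeOver S} {D : A.DualPair}
    (pol : A.Polarization D) {g : ℕ} {δ : Fin g → ℕ} (hT : pol.HasType δ) (s : Spec (.of ℂ) ⟶ S)
    {Θ : CartierDivisor (A.fibre s).toAbelianVariety.X.left} (hlam : A.IsLambdaOfAt s D pol.lam Θ)
    {ι : Type} [Fintype ι] [DecidableEq ι] {Φ : (ι → ℝ) ≃L[ℝ] (Fin (A.fibre s).toAbelianVariety.dim → ℂ)}
    {φ : ComplexTorus Φ → ComplexPoints (A.fibre s).toAbelianVariety.X}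
    (hφ : IsAnalytification (Fin (A.fibre s).toAbelianVariety.dim → ℂ) (A.fibre s).toAbelianVariety.X
      (A.fibre s).toAbelianVariety.dim φ)
    (hadd : ∀ x y, φ (x + y) = φ x * φ y) (hg : (A.fibre s).toAbelianVariety.dim = g) (p : AHData Φ)
    (hp : AHData.toPic p = picClass (cartierDivisorLineBundle hφ Θ)) (hR : IsRiemannForm Φ p.form) :
    ComplexTorus.IsPolarizationType Φ p.form δ := by
  obtain ⟨ψ, hψ, hrange⟩ := HasType.exists_mulHom_range_eq_KTheta pol hT s hlam
  exact (A.fibre s).toAbelianVariety.isPolarizationType_of_range_eq_KTheta hφ hadd Θ p hp hR hg hT.1 hψ hrange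

end Literature.AlgebraicGeometry.AbelianSchemes.AbelianSchemeOver.Polarization

end
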